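import Mathlib
import Summits.Ventures.PercRepro2.ZMeanProof
import Summits.Ventures.PercRepro2.PendantRoot
import Summits.Ventures.PercRepro2.HMFLeaf
import Summits.Ventures.PercRepro2.HMFPendantBEvents
import Summits.Ventures.PercRepro2.HMFPendantB
import Summits.Ventures.PercRepro2.HMFLeafStep

/-!
# The mean field is exact at an isolated `a₃`: `HMFc(p[f ↦ 0]) = 0` at any leaf edge
(blind cell PercRepro2, night-1 g6; NIGHT1-G6.md §12 — the endpoint `q = 0` of the (HMF) leaf step)

Let `a₃` be a leaf with its only edge `f = {a₃, y}` (`y` arbitrary).  With `f` closed `a₃` is isolated: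
`PD = Q`, `T = T′ = ∅`, `X̂ = termW({a₃})` with `P(Q)·termW({a₃}) = P(Q,oL)P(Q,bH) + P(Q,oH)P(Q,bL)`, and
`HMFc = 2P(Q)[(A_L + A_H)B_H − (A_L B_H + A_H B_L)] − (B_H − B_L)·2P(Q)A_H = 0`.  Together with
`HMFLeafStep.HMFc_leaf_eq` this gives `HMFc(p) = q·HMFc(p[f ↦ 1]) + q(1 − q)·κ` with
`κ = 4 HMFc(p[f ↦ ½]) − 2 HMFc(p[f ↦ 1])`: the **(HMF) leaf step** (`HMF_of_leaf_step`).
-/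

namespace Summit.Ventures.PercRepro2

open UnionCluster CovForm PendantRoot HMFPendantRoot HMFPendantB

namespace HMFLeafStep

variable {V : Type*} {E : Type*} [Fintype E] [DecidableEq E] [Fintype V] [DecidableEq V]
  {R : Type*} [Field R] [LinearOrder R] [IsStrictOrderedRing R]

variable (p : E → R) (ends : E → Sym2 V) {f : E} {a₃ y : V}

omit [LinearOrder R] [IsStrictOrderedRing R] in
/-- The split of `X̂` by the state of a leaf edge at `a₃` with an arbitrary neighbour `y`. -/
lemma Xhat_leaf_split (hf : ends f = s(a₃, y)) (hleaf : ∀ e, a₃ ∈ ends e → e = f) (h3y : a₃ ≠ y)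
    (o a₁ a₂ b : V) :
    Xhat p ends o a₁ a₂ a₃ b =
      (1 - p f) * termW p ends o a₁ a₂ b {a₃} +
        ∑ W : Finset V, prob p (clusterEvent ends y (↑W : Set V) ∩ openEdge f) *
          termW p ends o a₁ a₂ b W := by
  rw [Xhat_eq_sum]
  have hsplit : ∀ W : Finset V, prob p (clusterEvent ends a₃ (↑W : Set V)) =
      prob p (clusterEvent ends y (↑W : Set V) ∩ openEdge f) +
        (if (↑W : Set V) = {a₃} then prob p (closedEdge f) else 0) := by
    intro W
    rw [← prob_inter_add_prob_inter_compl p (clusterEvent ends a₃ (↑W : Set V)) (openEdge f),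
      ← closedEdge_eq_compl, clusterEvent_leaf_inter_open hf,
      clusterEvent_leaf_inter_closed hf hleaf h3y]
    congr 1
    split_ifs <;> simp
  simp only [hsplit, add_mul, Finset.sum_add_distrib]
  rw [add_comm]
  congr 1
  rw [Finset.sum_eq_single ({a₃} : Finset V)]
  · simp [prob_closedEdge]
  · intro W _ hW
    have : (↑W : Set V) ≠ {a₃} := by
      intro h
      apply hW
      rw [← Finset.coe_singleton] at h
      exact Finset.coe_injective h
    simp [this]
  · intro h
    exact absurd (Finset.mem_univ _) h

/-- `P(Q) · termW({a₃}) = P(Q,oL) P(Q,bH) + P(Q,oH) P(Q,bL)` at a leaf `a₃` with any neighbour `y`. -/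
lemma termW_leaf_gen (hp : IsProbVec p) (hf : ends f = s(a₃, y)) (hleaf : ∀ e, a₃ ∈ ends e → e = f)
    (h3y : a₃ ≠ y) {o a₁ a₂ b : V} (h31 : a₃ ≠ a₁) (h32 : a₃ ≠ a₂) (ho : o ≠ a₃) (hb : b ≠ a₃) :
    prob p (avoidAll ends a₂ {a₁}) * termW p ends o a₁ a₂ b {a₃} =
      prob p (avoidAll ends a₂ {a₁} ∩ connEvent ends a₁ o) *
          prob p (avoidAll ends a₂ {a₁} ∩ connEvent ends a₂ b) +
        prob p (avoidAll ends a₂ {a₁} ∩ connEvent ends a₂ o) *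
          prob p (avoidAll ends a₂ {a₁} ∩ connEvent ends a₁ b) := by
  have h1 : a₁ ∉ ({a₃} : Finset V) := by simp [Ne.symm h31]
  have h2 : a₂ ∉ ({a₃} : Finset V) := by simp [Ne.symm h32]
  have ho' : o ∉ ({a₃} : Finset V) := by simp [ho]
  have hb' : b ∉ ({a₃} : Finset V) := by simp [hb]
  simp only [termW, h1, h2, if_false, termPD, delShareMass, ho', hb',
    delQ_leaf_b ends hf hleaf h3y h31 h32, connDelEvent_leaf hf hleaf h3y (Ne.symm h31) ho,
    connDelEvent_leaf hf hleaf h3y (Ne.symm h32) hb,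
    connDelEvent_leaf hf hleaf h3y (Ne.symm h32) ho, connDelEvent_leaf hf hleaf h3y (Ne.symm h31) hb]
  by_cases hZ : prob p (avoidAll ends a₂ {a₁}) = 0
  · have hmono : ∀ X, prob p (avoidAll ends a₂ {a₁} ∩ X) = 0 := fun X =>
      le_antisymm (by rw [← hZ]; exact prob_mono hp Set.inter_subset_left) (prob_nonneg hp _)
    simp [hZ, hmono]
  · rw [mul_div_cancel₀ _ hZ]

/-- **The mean field is exact at an isolated `a₃`**: with the leaf edge closed, `HMFc = 0`. -/
theorem HMFc_update_zero (hp : IsProbVec p) (hf : ends f = s(a₃, y))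
    (hleaf : ∀ e, a₃ ∈ ends e → e = f) (h3y : a₃ ≠ y) {o a₁ a₂ b : V} (h31 : a₃ ≠ a₁) (h32 : a₃ ≠ a₂)
    (ho : o ≠ a₃) (hb : b ≠ a₃) : HMFc (Function.update p f 0) ends o a₁ a₂ a₃ b = 0 := by
  set p' := Function.update p f 0 with hp'
  have hpf : p' f = 0 := by simp [hp']
  have hpv : IsProbVec p' := hp.update f le_rfl zero_le_one
  have h13 : a₁ ≠ a₃ := Ne.symm h31
  have h23 : a₂ ≠ a₃ := Ne.symm h32
  have c₁o := free_connEvent hf hleaf h3y h13 ho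
  have c₂o := free_connEvent hf hleaf h3y h23 ho
  have c₁b := free_connEvent hf hleaf h3y h13 hb
  have c₂b := free_connEvent hf hleaf h3y h23 hb
  have ht := termW_leaf_gen p' ends hpv hf hleaf h3y h31 h32 ho hb
  have hX := Xhat_leaf_split p' ends hf hleaf h3y o a₁ a₂ b
  -- the open rows have mass `p' f = 0`
  have hopen : ∀ W : Finset V, prob p' (clusterEvent ends y (↑W : Set V) ∩ openEdge f) = 0 := by
    intro W
    refine le_antisymm ?_ (prob_nonneg hpv _)
    calc prob p' (clusterEvent ends y (↑W : Set V) ∩ openEdge f)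
        ≤ prob p' (openEdge f) := prob_mono hpv Set.inter_subset_right
      _ = 0 := by rw [prob_openEdge, hpf]
  simp only [hopen, zero_mul, Finset.sum_const_zero, add_zero, hpf, sub_zero, one_mul] at hX
  unfold HMFc marginC DEF EQo EQ3 EQ3o Do massM2 deltaT
  rw [gap_eq_Q, hX, Set.inter_comm (connEvent ends a₂ b) (TEvent ends a₁ a₂ a₃),
    Set.inter_comm (connEvent ends a₁ b) (TEvent ends a₁ a₂ a₃)]
  simp only [prob_PD_inter_b p' hf hleaf h3y h31 h32 c₁o, prob_PD_inter_b p' hf hleaf h3y h31 h32 c₂o,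
    prob_PD_inter_b p' hf hleaf h3y h31 h32 c₂b,
    prob_T_inter_b p' hf hleaf h3y h31 h32 c₁o, prob_T_inter_b p' hf hleaf h3y h31 h32 c₂o,
    prob_T_inter_b p' hf hleaf h3y h31 h32 c₁b, prob_T_inter_b p' hf hleaf h3y h31 h32 c₂b,
    prob_T'_inter_b p' hf hleaf h3y h31 h32 c₁o, prob_T'_inter_b p' hf hleaf h3y h31 h32 c₂o,
    prob_PD_b p' ends hf hleaf h3y h31 h32, prob_T_b p' ends hf hleaf h3y h31 h32,
    prob_T'_b p' ends hf hleaf h3y h31 h32, hpf, zero_mul, add_zero, sub_zero, mul_zero, one_mul,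
    sub_self]
  linear_combination (-2 * prob p' (avoidAll ends a₂ {a₁})) * ht

/-- **The (HMF) leaf step**: at a leaf `a₃` with edge `f = {a₃, y}` of weight `q = p f`,
`HMFc(p) = q · HMFc(p[f ↦ 1]) + q(1 − q) · κ` with `κ = 4 HMFc(p[f ↦ ½]) − 2 HMFc(p[f ↦ 1])`;
hence (HMF) at the leaf follows from (HMF) at the contracted instance and `κ ≥ 0`. -/
theorem HMF_of_leaf_step (hp : IsProbVec p) (hf : ends f = s(a₃, y))
    (hleaf : ∀ e, a₃ ∈ ends e → e = f) (h3y : a₃ ≠ y) {o a₁ a₂ b : V} (h31 : a₃ ≠ a₁) (h32 : a₃ ≠ a₂)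
    (ho : o ≠ a₃) (hb : b ≠ a₃)
    (hcontract : 0 ≤ HMFc (Function.update p f 1) ends o a₁ a₂ a₃ b)
    (hkappa : 0 ≤ 4 * HMFc (Function.update p f (1 / 2)) ends o a₁ a₂ a₃ b -
      2 * HMFc (Function.update p f 1) ends o a₁ a₂ a₃ b) :
    HMF p ends o a₁ a₂ a₃ b := by
  unfold HMF
  have key := HMFc_leaf_eq p ends hf hleaf h3y h31 h32 (Ne.symm ho) (Ne.symm hb) (p f)
  rw [Function.update_eq_self] at key
  rw [key, HMFc_update_zero p ends hp hf hleaf h3y h31 h32 ho hb]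
  have hq0 := hp.nonneg f
  have hq1 := sub_nonneg.2 (hp.le_one f)
  nlinarith [mul_nonneg hq0 hcontract, mul_nonneg (mul_nonneg hq0 hq1) hkappa]

end HMFLeafStep

end Summit.Ventures.PercRepro2
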